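import Mathlib
import Literature.Computability.Complexity.Classes
import Literature.Computability.Complexity.BoolEncodings
import Literature.Computability.Complexity.TM2PassThrough
import Literature.Computability.Complexity.Nondeterministic
import Literature.Computability.Complexity.Randomized
import Literature.Computability.Complexity.ProbabilisticClasses
import Literature.Computability.MetaComplexity.Magnification
import Literature.Computability.MetaComplexity.McKayMurrayWilliams2019.UniformStreaming
import HarnessLib

/-!
# Fu 2020: UNIFORM RANDOMIZED one-pass streaming algorithms, and Corollary 1 (streaming
# lower bounds for a sparse `NTIME(2^{n^{o(1)}})` language magnify to `NEXP ≠ BPP`) as a named fact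

Citation header. B. Fu, *Hardness of Sparse Sets and Minimal Circuit Size Problem*, Computing and
Combinatorics (COCOON 2020), LNCS, Springer (2020) 484–495, doi:10.1007/978-3-030-58150-3_39,
arXiv:2003.00669 [bib: `Fu2020`]. Theorem numbering and the page/line locators below are those of
the arXiv version (held text `paper:arxiv-2003.00669`, pages `p0004`–`p0007`). Printed, verbatim:

* (Cor. 1, p. 7, L80–84) *"If there exists a $2^{n^{o(1)}}$-sparse language $L$ in
  $NTIME(2^{n^{o(1)}})$ such that $L$ does not have any randomized streaming algorithm with
  $n^{o(1)}$ updating time, and $n^{o(1)}$ space, then $NEXP \ne BPP$."*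
* (Def. 4, p. 7, L68–78) *"A function $f(n):\mathbb N\to\mathbb N$ is $n^{o(1)}$ if there is a
  nondecreasing function $g(n):\mathbb N\to\mathbb N$ such that $\lim_{n\to+\infty} g(n)=+\infty$
  and $f(n)\le n^{1/g(n)}$ for all large $n$. A function $f(n):\mathbb N\to\mathbb N$ is
  $2^{n^{o(1)}}$ if there is a nondecreasing function $g(n):\mathbb N\to\mathbb N$ such that
  $\lim_{n\to+\infty} g(n)=+\infty$ and $f(n)\le 2^{n^{1/g(n)}}$ for all large $n$."*
* (Def. 2, p. 6, L14–17) *"Let $f(n)$ be a function from $N$ to $N$. For a language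
  $A\subseteq\{0,1\}^*$, we say $A$ is $f(n)$-sparse if $|A^n|\le f(n)$ for all large integer $n$."*
* (Def. 3, p. 6, L99–106) *"For a nondecreasing function $t(\cdot):\mathbb N\to\mathbb N$, define
  $PrTime(t(n))$ the class of languages $L$ that have two-side bounded error probabilistic
  algorithms with time complexity $O(t(n))$. Define $BPP=\cup_{c=1}^{\infty} PrTime(n^c)$."*
* (Def. 1, p. 4, L67–90, the paper's own streaming class `Streaming(r₀(n), r₁(n), s(n), u(n), r₂(n))`)
  *"… the class of languages $L$ that have one-pass streaming algorithms that has input $(n, x)$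
  with $n=|x|$ ($x$ is a string and read by streaming), it satisfies: It takes $r_0(n)$ time to
  generate a field $F=GF(2^k)$ …; It takes $O(r_1(n))$ random steps before reading the first bit
  from the input stream $x$; It uses $O(s(n))$ space that includes the space to hold the field
  representation generated by the algorithm …; It takes $O(u(n))$ field conversions to elements in
  $F$ and $O(u(n))$ field operations in $F$ after reading each bit; It runs $O(r_2(n))$ randomized
  steps after reading the entire input."*
* (Thm. 2, p. 6, L108–122, the parametric main theorem) *"… If there is a $f(n)$-sparse set $L$
  with $L\in NTIME(t_1(n))$ and $L\notin Streaming(u_1(10v(n)), v(n), v(n), 1, t_3(10v(n)))$,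
  then there is a language $A$ such that $A\in NTIME(t_2(n))$ and $A\notin PrTime(t_3(n))$."*
  The proof of Cor. 1 (p. 7, L86–120) instantiates Thm. 2 with ONE nondecreasing unbounded
  `g ≤ log log n`, `t₁(n) = f(n) = 2^{n^{1/g(n)}}`, `t₂(n) = 2^{2n}`, `t₃(n) = n^{√g(n)}`,
  `v(n) = log n + log f(n)`, checks that the field-generation time `r₀ = poly(v(n))`, the
  pre-reading random steps `r₁ = v(n)`, the space `v(n)`, the per-bit work and the post-reading
  time `r₂ = t₃(10v(n))` are ALL `n^{o(1)}`, and concludes (L110–113) *"Thus, the streaming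
  algorithm updating time is $n^{o(1)}$. Therefore, we have that $L$ has a randomized streaming
  algorithm with $n^{o(1)}$ updating time, and $n^{o(1)}$ space. This gives a contradiction."* —
  so in Cor. 1 "updating time" covers the pre-processing before the first bit and the
  post-processing after the last one.

What is here (typed, not proved): a UNIFORM RANDOMIZED one-pass streaming class `RSTREAM S T`
(the randomized analogue of the tree's `McKayMurrayWilliams2019.USTREAM`), Fu's Def. 4 rate
functions `subexpRate g` (`2^{⌈n^{1/g(n)}⌉}`) and `subpolyBound g c` (`c·⌈N^{1/g(N)}⌉ + c`), the
hypothesis shape `SubpolyStreamingHard L` ("no randomized streaming algorithm with `n^{o(1)}`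
updating time and `n^{o(1)}` space"), and COROLLARY 1 as the named fact `cor1`. PROVED:
monotonicity (`RSTREAM_mono`), inhabitedness of the classes (`zero_mem_RSTREAM`, and
`zero_mem_RSTREAM_lllRate` — a member of the `n^{o(1)}` family itself, at the legitimate Def.-4
index `lllRate N = ⌊log₂⌊log₂⌊log₂ N⌋⌋⌋ + 1`, contains the empty language, so
`SubpolyStreamingHard L` is a genuine lower bound and not membership failure in empty classes),
and `SubpolyStreamingHard.not_mem_of_le_rpow` (the family covers print's notion: a
`SubpolyStreamingHard` language has no algorithm whose updating time and space are bounded by ANY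
function that is `n^{o(1)}` in the sense of Def. 4, via `exists_le_subpolyBound`). Deliberately NOT
here: Thm. 2 itself (its class `Streaming(r₀,r₁,s,u,r₂)` is specific to the `GF(2^k)` Horner
fingerprint and has five parameters), the proof of Cor. 1, the paper's second result (`MCSP` is
`ZPP ∩ TALLY(d,g)`-hard ⟹ `EXP ≠ ZPP`: a hardness-of-`MCSP` statement, not a lower-bound
magnification), and any LOWER BOUND against `RSTREAM` (none is in print for sparse `NTIME` sets;
the tree's deterministic `USTREAM` lower bounds concern dense languages).

## Design of `RSTREAM S T` (each choice makes the class LARGER or equal than a literal reading of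
## "randomized streaming algorithm with updating time `T` and space `S`", hence the hypothesis
## `L ∉ RSTREAM …` STRONGER or equal, hence the vended implication `cor1` WEAKER or equal than print)

* An algorithm (`RStreamingAlgorithm`) is the tree's `StreamingAlgorithm` shape with COINS: at
  input length `N` the update map receives the current state, the next input bit and a block of
  `updCoins N` FRESH coin bits, and the report map receives the final state and `repCoins N` fresh
  coin bits; the initial state is empty (w.l.o.g.: `N` is supplied at every update, so the first
  update can do any pre-processing — Fu's `r₀(n)` field generation and `r₁(n)` "random steps before
  reading the first bit" — and store its result and its coins in the state). The coin string of a
  run on `x`, `|x| = N`, is ONE uniformly random `y ∈ {0,1}^{coinLen N}`,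
  `coinLen N = N·updCoins N + repCoins N`, consumed block by block (`coinsAt`, `repCoinsOf`).
* Acceptance is TWO-SIDED BOUNDED ERROR exactly as in the tree's `Complexity.bp` / `BPP`
  (`DecidesBP`: for every `x`, at least `2/3` of the coin strings give the right verdict,
  `uniformProb`). Fu's "randomized … algorithm" is the two-sided bounded-error notion of his Def. 3;
  the constant `2/3` is immaterial for the `n^{o(1)}` family (run `O(1)` independent copies in
  parallel: space and time grow by a constant factor).
* UNIFORMITY, as in `USTREAM` and as in print (an ALGORITHM with input `(n, x)`): ONE `TM2` machine
  computes every update, `⟨N, ⟨state, ⟨[b], coins⟩⟩⟩ ↦ next state` (`HasUniformUpdateTime`), and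
  ONE `TM2` machine computes the report, `⟨N, ⟨final state, coins⟩⟩ ↦ [verdict]`
  (`HasUniformReportTime`), each within `T N` steps; space `S N` bounds the stored state between
  two input bits on actual runs (`RunsInSpace`; the machines' work space during an update is not
  charged, which only enlarges the class). A non-uniform rendering (machines depending on `N`)
  would be WRONG here, not merely weaker: every `2^{n^{o(1)}}`-sparse language has `n^{o(1)}`-space
  one-pass algorithms non-uniformly (inject the slice into short fingerprints), so the hypothesis
  of Cor. 1 would be unsatisfiable; likewise an uncharged report step would let a fingerprint plus
  brute force decide every sparse decidable language. Print charges both (quotation above).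
* Multitape `TM2` machines re-reading `N` and the state at every step cost `O(S + log N)` extra
  time per update relative to a RAM; since `log N` and every `n^{o(1)}` bound composed with a
  polynomial are again `n^{o(1)}`, the UNION over the family below is unchanged. Individual members
  `RSTREAM (subpolyBound g c) (subpolyBound g c)` with a FAST index `g` (time `≈ 2c`, less than the
  `≥ 2 log₂ N` bits of the update machine's input) are empty by this artefact; the hypothesis
  `SubpolyStreamingHard` quantifies over ALL indices, and slow ones give non-empty classes
  (`zero_mem_RSTREAM_lllRate`), so nothing is vacuous.
* "`n^{o(1)}` updating time and `n^{o(1)}` space" is rendered by Def. 4 LITERALLY: for every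
  nondecreasing unbounded `g' : ℕ → ℕ` and every constant `c`, `L ∉ RSTREAM (c⌈N^{1/g'(N)}⌉ + c)
  (c⌈N^{1/g'(N)}⌉ + c)` (one bound for time and space and one `g'` lose nothing: the classes are
  monotone, take the smaller `g'` and the larger `c`; the additive/multiplicative `c` absorbs
  finitely many lengths and `O(·)`). A bound `f` that is `n^{o(1)}` in the sense of Def. 4 satisfies
  `f ≤ c⌈N^{1/g'}⌉ + c` for its `g'` and a suitable `c`, and conversely `c⌈N^{1/g'}⌉ + c` is
  `n^{o(1)}` (index `min(⌊g'/2⌋, ⌊log₂ log₂ N⌋)`), so the union of the family is print's notion.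
* "`2^{n^{o(1)}}`-sparse language in `NTIME(2^{n^{o(1)}})`" is rendered with ONE Def.-4 index `g`
  for both (as the printed proof does: `t₁ = f = 2^{n^{1/g}}`) and the specific rate
  `subexpRate g n = 2^{⌈n^{1/g(n)}⌉}`: eventually `|L ∩ {0,1}ⁿ| ≤ subexpRate g n` (Def. 2: "for all
  large n") and `L ∈ NTIME (subexpRate g)` (the tree's verifier-form `NTIME`, robust under `O(·)`).
  Both imply the printed hypotheses: `2^{⌈n^{1/g}⌉} ≤ 2^{n^{1/g~(n)}}` for all large `n` with the
  nondecreasing unbounded `g~ = min(⌊g/2⌋, ⌊log₂ log₂ n⌋)`, and verifier-form `NTIME(t)` is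
  contained in machine-form `NTIME(O(t(n) + n))`; for indices `g` so fast that `subexpRate g n < n`
  the tree's class `NTIME (subexpRate g)` is degenerate (empty), which only makes those instances
  of `cor1` vacuously true — the substantive range is `g ≤ log₂ log₂ n`, which the printed proof
  assumes without loss of generality.
* The conclusion is the tree's `NEXP ≠ BPP` (`Complexity.NEXP = ⋃ₖ NTIME(2^{n^k})`,
  `Complexity.BPP = bp P`), the standard classes of Fu's Def. 3 / §2.
-/

noncomputable section

open Computability Filter

namespace Literature.Computability.MetaComplexity.Fu2020

open Literature.Computability.Complexity Literature.Computability.MetaComplexity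

/-! ### Randomized one-pass streaming algorithms and their runs -/

/-- A (uniform-shape) RANDOMIZED one-pass streaming algorithm: at input length `N`, an update map
`(state, bit, fresh coins) ↦ state'` fed `updCoins N` fresh coin bits per input bit, and a report
map `(final state, fresh coins) ↦ verdict` fed `repCoins N` coin bits; the initial state is the
empty word (module docstring). [cite: Fu2020, Def. 1 and Cor. 1 (randomized streaming algorithm)] -/
structure RStreamingAlgorithm where
  /-- number of fresh coin bits supplied to each update at input length `N` -/
  updCoins : ℕ → ℕ
  /-- number of fresh coin bits supplied to the report at input length `N` -/
  repCoins : ℕ → ℕ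
  /-- the update map at input length `N`: `(state, bit, coins) ↦ state'` -/
  update : ℕ → List Bool → Bool → List Bool → List Bool
  /-- the report at input length `N`: `(final state, coins) ↦ accept?` -/
  accept : ℕ → List Bool → List Bool → Bool

namespace RStreamingAlgorithm

variable (A : RStreamingAlgorithm)

/-- The block of coins handed to the update reading input bit number `i` (0-based) at input
length `N`, out of the run's coin string `y`. [cite: Fu2020, Def. 1 (random steps)] -/
def coinsAt (N i : ℕ) (y : List Bool) : List Bool :=
  (y.drop (i * A.updCoins N)).take (A.updCoins N)

/-- The coins left for the report at input length `N`: everything after the `N` update blocks.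
[cite: Fu2020, Def. 1 (randomized steps after reading the entire input)] -/
def repCoinsOf (N : ℕ) (y : List Bool) : List Bool :=
  y.drop (N * A.updCoins N)

/-- Total number of coin bits of a run at input length `N`. [cite: Fu2020, Def. 1] -/
def coinLen (N : ℕ) : ℕ :=
  N * A.updCoins N + A.repCoins N

/-- The run: from state `st`, the next input bit being bit number `i`, read the word `x` with coin
string `y` (at input length `N`). [cite: Fu2020, Def. 1 (one-pass streaming)] -/
def runFrom (N : ℕ) (y : List Bool) : List Bool → ℕ → List Bool → List Bool
  | st, _, [] => st
  | st, i, b :: x => runFrom N y (A.update N st b (A.coinsAt N i y)) (i + 1) x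

/-- The state reached after reading the prefix `x` with coin string `y`, from the empty initial
state, at input length `N`. [cite: Fu2020, Def. 1 (one-pass streaming)] -/
def reach (N : ℕ) (x y : List Bool) : List Bool :=
  A.runFrom N y [] 0 x

/-- The verdict on input `x` under the coin string `y`. [cite: Fu2020, Def. 1] -/
def acceptsWith (x y : List Bool) : Bool :=
  A.accept x.length (A.reach x.length x y) (A.repCoinsOf x.length y)

/-- Reading one more bit applies the update map with the next coin block. [folklore] -/
theorem runFrom_append_singleton (N : ℕ) (y st : List Bool) (i : ℕ) (x : List Bool) (b : Bool) :
    A.runFrom N y st i (x ++ [b]) =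
      A.update N (A.runFrom N y st i x) b (A.coinsAt N (i + x.length) y) := by
  induction x generalizing st i with
  | nil => simp [runFrom]
  | cons a x ih =>
    simp only [List.cons_append, runFrom, List.length_cons]
    rw [ih, show i + 1 + x.length = i + (x.length + 1) by omega]

/-- Before reading anything the state is empty. [folklore] -/
@[simp] theorem reach_nil (N : ℕ) (y : List Bool) : A.reach N [] y = [] := rfl

/-- Reading one more bit applies the update map with the coin block of that bit. [folklore] -/
theorem reach_append_singleton (N : ℕ) (x y : List Bool) (b : Bool) :
    A.reach N (x ++ [b]) y = A.update N (A.reach N x y) b (A.coinsAt N x.length y) := by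
  simp [reach, runFrom_append_singleton]

/-- **Two-sided bounded-error decision** (as in the tree's `Complexity.bp`): for every input `x`,
at least `2/3` of the coin strings of length `coinLen |x|` give the verdict `x ∈ L`.
[cite: Fu2020, Def. 3 (two-side bounded error) and Cor. 1] -/
def DecidesBP (L : Language Bool) : Prop :=
  ∀ x : List Bool,
    2 / 3 ≤ uniformProb (A.coinLen x.length) {y : List Bool | A.acceptsWith x y = true ↔ x ∈ L}

/-- **Space `S` on runs**: every state stored between two input bits on a run at input length `N`
(any prefix, any coin string of the run's length) has at most `S N` bits.
[cite: Fu2020, Def. 1 (space) and Cor. 1] -/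
def RunsInSpace (S : ℕ → ℕ) : Prop :=
  ∀ (N : ℕ) (x y : List Bool), x.length ≤ N → y.length = A.coinLen N →
    (A.reach N x y).length ≤ S N

/-- **Uniform update time `T`**: ONE `TM2` machine, given `N` in binary, the reached state, the
next bit and that bit's coin block, outputs the next state within `T N` steps (this covers Fu's
pre-processing `r₀, r₁` at the first bit and the per-bit work `u`).
[cite: Fu2020, Def. 1 (updating) and Cor. 1] -/
def HasUniformUpdateTime (T : ℕ → ℕ) : Prop :=
  ∃ M : Turing.TM2ComputableAux Bool Bool, ∀ (N : ℕ) (x y : List Bool) (b : Bool),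
    x.length < N → y.length = A.coinLen N →
      M.OutputsWithin
        (boolPair (encodeNat N) (boolPair (A.reach N x y) (boolPair [b] (A.coinsAt N x.length y))))
        (A.reach N (x ++ [b]) y) (T N)

/-- **Uniform reporting time `T`**: ONE `TM2` machine, given `N = |x|` in binary, the final state
and the report coins, outputs the verdict bit within `T N` steps (Fu's `r₂`, "randomized steps
after reading the entire input"). [cite: Fu2020, Def. 1 (steps after reading) and Cor. 1] -/
def HasUniformReportTime (T : ℕ → ℕ) : Prop :=
  ∃ M : Turing.TM2ComputableAux Bool Bool, ∀ x y : List Bool, y.length = A.coinLen x.length →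
    M.OutputsWithin
      (boolPair (encodeNat x.length) (boolPair (A.reach x.length x y) (A.repCoinsOf x.length y)))
      [A.acceptsWith x y] (T x.length)

end RStreamingAlgorithm

/-- **`RSTREAM S T`**: languages decided with two-sided error `≤ 1/3` by a UNIFORM RANDOMIZED
one-pass streaming algorithm storing at most `S N` bits between input bits and spending at most
`T N` steps per update and on the report (module docstring for the modelling choices).
[cite: Fu2020, Cor. 1 (randomized streaming algorithm with given updating time and space)] -/
def RSTREAM (S T : ℕ → ℕ) : Set (Language Bool) :=
  {L | ∃ A : RStreamingAlgorithm, A.RunsInSpace S ∧ A.HasUniformUpdateTime T ∧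
    A.HasUniformReportTime T ∧ A.DecidesBP L}

/-- `RSTREAM` is monotone in the space and time bounds. [folklore] -/
theorem RSTREAM_mono {S S' T T' : ℕ → ℕ} (hS : ∀ N, S N ≤ S' N) (hT : ∀ N, T N ≤ T' N) :
    RSTREAM S T ⊆ RSTREAM S' T' := by
  rintro L ⟨A, hS', ⟨M, hM⟩, ⟨M', hM'⟩, hD⟩
  exact ⟨A, fun N x y hx hy => (hS' N x y hx hy).trans (hS N),
    ⟨M, fun N x y b hx hy => (hM N x y b hx hy).mono (hT N)⟩,
    ⟨M', fun x y hy => (hM' x y hy).mono (hT _)⟩, hD⟩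

/-! ### Fu's Definition 4: the rate functions -/

/-- The subexponential rate `n ↦ 2^{⌈n^{1/g(n)}⌉}` of a Def.-4 index `g` (rendering
"`2^{n^{o(1)}}`": *"f(n) ≤ 2^{n^{1/g(n)}} for all large n"* for a nondecreasing unbounded `g`).
[cite: Fu2020, Def. 4] -/
def subexpRate (g : ℕ → ℕ) (n : ℕ) : ℕ :=
  2 ^ ⌈(n : ℝ) ^ (1 / (g n : ℝ))⌉₊

/-- The subpolynomial bound `N ↦ c·⌈N^{1/g(N)}⌉ + c` of a Def.-4 index `g` and a constant `c`
(rendering "`n^{o(1)}`": *"f(n) ≤ n^{1/g(n)} for all large n"*, with the constant `c` absorbing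
`O(·)` and the finitely many small lengths). [cite: Fu2020, Def. 4] -/
def subpolyBound (g : ℕ → ℕ) (c : ℕ) (N : ℕ) : ℕ :=
  c * ⌈(N : ℝ) ^ (1 / (g N : ℝ))⌉₊ + c

/-- `c ≤ c·⌈N^{1/g(N)}⌉ + c`. [folklore] -/
theorem le_subpolyBound (g : ℕ → ℕ) (c N : ℕ) : c ≤ subpolyBound g c N :=
  Nat.le_add_left c _

/-- `⌈N^{1/m}⌉ ≤ N + 1` for all naturals `N, m` (the exponent `1/m ≤ 1`, and `1/0 = 0`). [folklore] -/
theorem ceil_rpow_inv_le (N m : ℕ) : ⌈(N : ℝ) ^ (1 / (m : ℝ))⌉₊ ≤ N + 1 := by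
  have hexp : (1 : ℝ) / (m : ℝ) ≤ 1 := by
    rcases Nat.eq_zero_or_pos m with hm | hm
    · simp [hm]
    · rw [div_le_one (by exact_mod_cast hm)]
      exact_mod_cast hm
  have hexp0 : (0 : ℝ) ≤ 1 / (m : ℝ) := by positivity
  rcases Nat.eq_zero_or_pos N with hN | hN
  · subst hN
    rcases eq_or_ne ((1 : ℝ) / (m : ℝ)) 0 with h0 | h0
    · rw [h0]; simp
    · rw [Nat.cast_zero, Real.zero_rpow h0]; simp
  · have h1 : (1 : ℝ) ≤ (N : ℝ) := by exact_mod_cast hN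
    have hle : (N : ℝ) ^ (1 / (m : ℝ)) ≤ (N : ℝ) := Real.rpow_le_self_of_one_le h1 hexp
    have : ⌈(N : ℝ) ^ (1 / (m : ℝ))⌉₊ ≤ N := Nat.ceil_le.2 (by exact_mod_cast hle)
    omega

/-- `subpolyBound g c N ≤ c·(N+1) + c`. [folklore] -/
theorem subpolyBound_le (g : ℕ → ℕ) (c N : ℕ) : subpolyBound g c N ≤ c * (N + 1) + c :=
  Nat.add_le_add_right (Nat.mul_le_mul_left c (ceil_rpow_inv_le N (g N))) c

/-! ### The hypothesis shape and Corollary 1 -/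

/-- **"`L` has no randomized streaming algorithm with `n^{o(1)}` updating time and `n^{o(1)}`
space"** (Def. 4 read literally, uniform `TM2` rendering): for every nondecreasing unbounded index
`g'` and every constant `c`, `L ∉ RSTREAM (c⌈N^{1/g'(N)}⌉ + c) (c⌈N^{1/g'(N)}⌉ + c)`.
[cite: Fu2020, Cor. 1 (hypothesis) and Def. 4] -/
def SubpolyStreamingHard (L : Language Bool) : Prop :=
  ∀ g' : ℕ → ℕ, Monotone g' → Tendsto g' atTop atTop →
    ∀ c : ℕ, L ∉ RSTREAM (subpolyBound g' c) (subpolyBound g' c)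

/-- **Fu 2020, Corollary 1 — hardness magnification from uniform randomized streaming lower
bounds for a sparse `NTIME(2^{n^{o(1)}})` language up to `NEXP ≠ BPP`** (uniform-`TM2`,
two-sided-error form; module docstring for why this is implied by the printed *"If there exists
a $2^{n^{o(1)}}$-sparse language $L$ in $NTIME(2^{n^{o(1)}})$ such that $L$ does not have any
randomized streaming algorithm with $n^{o(1)}$ updating time, and $n^{o(1)}$ space, then
$NEXP\ne BPP$"*): for every nondecreasing unbounded `g : ℕ → ℕ` and every language `L` that is
eventually `2^{⌈n^{1/g(n)}⌉}`-sparse and lies in `NTIME(2^{⌈n^{1/g(n)}⌉})`,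
`SubpolyStreamingHard L → NEXP ≠ BPP`. Printed proof (p. 7): Thm. 2 with `t₁ = f = 2^{n^{1/g}}`,
`t₂ = 2^{2n}`, `t₃(n) = n^{√g(n)}` produces `A ∈ NTIME(2^{2n}) ⊆ NEXP` with `A ∉ PrTime(t₃)`,
hence `A ∉ BPP`; the streaming algorithm that would otherwise exist stores a `GF(2^k)` Horner
fingerprint of `x` at a random point (`k = O(log n + log f(n)) = n^{o(1)}` bits) and runs the
`BPP` machine for `A` on it. [cite: Fu2020, Cor. 1] -/
def cor1 : Prop :=
  ∀ g : ℕ → ℕ, Monotone g → Tendsto g atTop atTop →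
    ∀ L : Language Bool,
      (∀ᶠ n in atTop, {x : List Bool | x ∈ L ∧ x.length = n}.ncard ≤ subexpRate g n) →
      L ∈ NTIME (subexpRate g) →
      SubpolyStreamingHard L →
        NEXP ≠ BPP

/-- **Consequence shape** (how the fact is consumed): one Def.-4 index `g` and one eventually
`2^{⌈n^{1/g}⌉}`-sparse `L ∈ NTIME(2^{⌈n^{1/g}⌉})` without `n^{o(1)}` randomized streaming
algorithms separate `NEXP` from `BPP`. [cite: Fu2020, Cor. 1] -/
theorem NEXP_ne_BPP_of_subpolyStreamingHard (h : cor1) {g : ℕ → ℕ} (hg : Monotone g)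
    (hg' : Tendsto g atTop atTop) {L : Language Bool}
    (hsp : ∀ᶠ n in atTop, {x : List Bool | x ∈ L ∧ x.length = n}.ncard ≤ subexpRate g n)
    (hNT : L ∈ NTIME (subexpRate g)) (hhard : SubpolyStreamingHard L) : NEXP ≠ BPP :=
  h g hg hg' L hsp hNT hhard

/-- **Every Def.-4 bound is dominated by a member of the family**: if `f(N) ≤ N^{1/g(N)}` for all
large `N`, then `f ≤ c·⌈N^{1/g(N)}⌉ + c` everywhere for a suitable constant `c` (the finitely many
small lengths are absorbed by `c`). [folklore] -/
theorem exists_le_subpolyBound {f g : ℕ → ℕ}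
    (hf : ∀ᶠ N in atTop, (f N : ℝ) ≤ (N : ℝ) ^ (1 / (g N : ℝ))) :
    ∃ c : ℕ, ∀ N, f N ≤ subpolyBound g c N := by
  obtain ⟨N₀, hN₀⟩ := eventually_atTop.1 hf
  refine ⟨(Finset.range N₀).sum f + 1, fun N => ?_⟩
  rcases Nat.lt_or_ge N N₀ with hN | hN
  · have : f N ≤ (Finset.range N₀).sum f :=
      Finset.single_le_sum (fun _ _ => Nat.zero_le _) (Finset.mem_range.2 hN)
    exact this.trans ((Nat.le_succ _).trans (le_subpolyBound _ _ _))
  · have h1 : f N ≤ ⌈(N : ℝ) ^ (1 / (g N : ℝ))⌉₊ := by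
      have := (hN₀ N hN).trans (Nat.le_ceil _)
      exact_mod_cast this
    unfold subpolyBound
    exact (h1.trans (Nat.le_mul_of_pos_left _ (Nat.succ_pos _))).trans (Nat.le_add_right _ _)

/-- **The family covers print's notion** (one direction of the modelling audit, PROVED): a
language without `n^{o(1)}` randomized streaming algorithms in the sense of
`SubpolyStreamingHard` has none with updating time and space bounded by ANY function `f` that is
`n^{o(1)}` in the sense of Def. 4 (`f(N) ≤ N^{1/g(N)}` for all large `N`, `g` nondecreasing and
unbounded). [folklore] -/
theorem SubpolyStreamingHard.not_mem_of_le_rpow {L : Language Bool} (h : SubpolyStreamingHard L)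
    {f g : ℕ → ℕ} (hg : Monotone g) (hg' : Tendsto g atTop atTop)
    (hf : ∀ᶠ N in atTop, (f N : ℝ) ≤ (N : ℝ) ^ (1 / (g N : ℝ))) : L ∉ RSTREAM f f := by
  obtain ⟨c, hc⟩ := exists_le_subpolyBound hf
  exact fun hL => h g hg hg' c (RSTREAM_mono hc hc hL)

/-! ### Non-vacuity: the trivial language -/

namespace Trivial

/-- The randomized streaming algorithm that draws no coins, stores nothing and rejects. [folklore] -/
def rejectAll : RStreamingAlgorithm where
  updCoins _ := 0
  repCoins _ := 0
  update _ _ _ _ := []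
  accept _ _ _ := false

/-- `rejectAll` is always in the empty state. [folklore] -/
@[simp] theorem reach_rejectAll (N : ℕ) (x y : List Bool) : rejectAll.reach N x y = [] := by
  induction x using List.reverseRecOn with
  | nil => rfl
  | append_singleton x b _ => rw [RStreamingAlgorithm.reach_append_singleton]; rfl

/-- `rejectAll` draws no coins. [folklore] -/
@[simp] theorem coinLen_rejectAll (N : ℕ) : rejectAll.coinLen N = 0 := by
  simp [RStreamingAlgorithm.coinLen, rejectAll]

/-- `rejectAll` rejects. [folklore] -/
@[simp] theorem acceptsWith_rejectAll (x y : List Bool) : rejectAll.acceptsWith x y = false := rfl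

end Trivial

/-- **Non-vacuity of `RSTREAM`**: the empty language is in `RSTREAM S T` as soon as
`T N ≥ 4⌊log₂ N⌋ + 22` (time to read `N` and the separators, and answer). [folklore] -/
theorem zero_mem_RSTREAM {S T : ℕ → ℕ} (hT : ∀ N, 4 * Nat.log 2 N + 22 ≤ T N) :
    (0 : Language Bool) ∈ RSTREAM S T := by
  obtain ⟨M, hM⟩ := McKayMurrayWilliams2019.Trivial.exists_const_machine []
  obtain ⟨M', hM'⟩ := McKayMurrayWilliams2019.Trivial.exists_const_machine [false]
  refine ⟨Trivial.rejectAll, fun N x y _ _ => by simp, ⟨M, fun N x y b _ _ => ?_⟩,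
    ⟨M', fun x y hy => ?_⟩, fun x => ?_⟩
  · have hlen := TM2Pass.length_encodeNat_le N
    have hcoins : Trivial.rejectAll.coinsAt N x.length y = [] := by
      simp [RStreamingAlgorithm.coinsAt, Trivial.rejectAll]
    simp only [Trivial.reach_rejectAll, hcoins]
    refine (hM (boolPair (encodeNat N) (boolPair [] (boolPair [b] [])))).mono ?_
    simp only [length_boolPair, List.length_nil, List.length_singleton]
    have := hT N
    omega
  · have hlen := TM2Pass.length_encodeNat_le x.length
    have hy0 : y = [] := by simpa using hy
    have hrep : Trivial.rejectAll.repCoinsOf x.length y = [] := by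
      simp [RStreamingAlgorithm.repCoinsOf, hy0]
    simp only [Trivial.reach_rejectAll, hrep, Trivial.acceptsWith_rejectAll]
    refine (hM' (boolPair (encodeNat x.length) (boolPair [] []))).mono ?_
    simp only [length_boolPair, List.length_nil, List.length_singleton]
    have := hT x.length
    omega
  · have hset : {y : List Bool | Trivial.rejectAll.acceptsWith x y = true ↔
        x ∈ (0 : Language Bool)} = Set.univ := by
      ext y
      simp only [Trivial.acceptsWith_rejectAll, Set.mem_setOf_eq, Set.mem_univ, iff_true]
      exact iff_of_false (by simp) (Language.notMem_zero x)
    rw [Trivial.coinLen_rejectAll, hset, uniformProb_univ]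
    norm_num

/-! ### Non-vacuity of the `n^{o(1)}` family: the triple-logarithmic index -/

/-- The Def.-4 index `N ↦ ⌊log₂⌊log₂⌊log₂ N⌋⌋⌋ + 1` (nondecreasing, unbounded, `≥ 1`).
[cite: Fu2020, Def. 4] -/
def lllRate (N : ℕ) : ℕ :=
  Nat.log 2 (Nat.log 2 (Nat.log 2 N)) + 1

/-- `lllRate` is nondecreasing. [folklore] -/
theorem lllRate_monotone : Monotone lllRate := fun _ _ h =>
  Nat.add_le_add_right (Nat.log_mono_right (Nat.log_mono_right (Nat.log_mono_right h))) 1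

/-- `lllRate` is unbounded. [folklore] -/
theorem tendsto_lllRate_atTop : Tendsto lllRate atTop atTop := by
  refine tendsto_atTop_atTop.2 fun b => ⟨2 ^ 2 ^ 2 ^ b, fun N hN => ?_⟩
  have h1 : 2 ^ 2 ^ b ≤ Nat.log 2 N := Nat.le_log_of_pow_le one_lt_two hN
  have h2 : 2 ^ b ≤ Nat.log 2 (Nat.log 2 N) := Nat.le_log_of_pow_le one_lt_two h1
  have h3 : b ≤ Nat.log 2 (Nat.log 2 (Nat.log 2 N)) := Nat.le_log_of_pow_le one_lt_two h2
  exact h3.trans (Nat.le_succ _)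

/-- `(⌊log₂ j⌋ + 1)·j ≤ 2^j` for every natural `j`. [folklore] -/
theorem log_succ_mul_le_two_pow (j : ℕ) : (Nat.log 2 j + 1) * j ≤ 2 ^ j := by
  rcases Nat.lt_or_ge j 4 with hj | hj
  · have h2 : Nat.log 2 2 = 1 := Nat.log_eq_of_pow_le_of_lt_pow (by norm_num) (by norm_num)
    have h3 : Nat.log 2 3 = 1 := Nat.log_eq_of_pow_le_of_lt_pow (by norm_num) (by norm_num)
    interval_cases j
    · simp
    · simp [Nat.log_one_right]
    · simp [h2]
    · simp [h3]
  · have hlog : Nat.log 2 j + 1 ≤ j := Nat.log_lt_self 2 (by omega)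
    have hsq : j * j ≤ 2 ^ j := by
      -- `j² ≤ 2^j` for `j ≥ 4`, by induction
      obtain ⟨d, rfl⟩ := Nat.exists_eq_add_of_le hj
      clear hj hlog
      induction d with
      | zero => norm_num
      | succ d ih =>
        have h4 : 2 + d < 2 ^ (2 + d) := Nat.lt_two_pow_self
        have hsplit : 2 ^ (4 + d) = 4 * 2 ^ (2 + d) := by
          rw [show 4 + d = 2 + (2 + d) by omega, pow_add]; norm_num
        have h2 : 2 * (4 + d) + 1 ≤ 2 ^ (4 + d) := by omega
        rw [show 4 + (d + 1) = 4 + d + 1 by omega, pow_succ]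
        nlinarith [ih, h2]
    exact (Nat.mul_le_mul_right j hlog).trans hsq

/-- The key estimate: `4⌊log₂ N⌋ + 22 ≤ subpolyBound lllRate c N` for `c ≥ 22` — at the
triple-logarithmic index the Def.-4 bound dominates the cost of reading `N`. [folklore] -/
theorem log_le_subpolyBound_lllRate {c : ℕ} (hc : 22 ≤ c) (N : ℕ) :
    4 * Nat.log 2 N + 22 ≤ subpolyBound lllRate c N := by
  rcases Nat.eq_zero_or_pos N with hN | hN
  · subst hN
    simp only [Nat.log_zero_right, mul_zero, zero_add]
    exact hc.trans (le_subpolyBound _ _ _)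
  set m := Nat.log 2 N with hm
  set j := Nat.log 2 m with hj
  set k := lllRate N with hk
  have hk1 : 1 ≤ k := Nat.le_add_left 1 _
  have hkj : k * j ≤ m := by
    rcases Nat.eq_zero_or_pos m with hm0 | hm0
    · have : j = 0 := by rw [hj, hm0]; simp
      rw [this, mul_zero]; exact Nat.zero_le _
    · calc k * j = (Nat.log 2 j + 1) * j := by rw [hk, lllRate, ← hm, ← hj]
        _ ≤ 2 ^ j := log_succ_mul_le_two_pow j
        _ ≤ m := Nat.pow_log_le_self 2 (by omega)
  -- `2^(k*j) ≤ 2^m ≤ N`, hence `2^j ≤ N^{1/k}`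
  have hpowN : 2 ^ (k * j) ≤ N :=
    (Nat.pow_le_pow_right two_pos hkj).trans (Nat.pow_log_le_self 2 (by omega))
  have hreal : ((2 : ℝ) ^ j) ≤ (N : ℝ) ^ (1 / (k : ℝ)) := by
    have hk0 : (k : ℝ) ≠ 0 := by exact_mod_cast (by omega : k ≠ 0)
    have hcast : (((2 : ℝ) ^ j) ^ k : ℝ) ≤ (N : ℝ) := by
      rw [← pow_mul, mul_comm]; exact_mod_cast hpowN
    have h := Real.rpow_le_rpow (by positivity) hcast (by positivity : (0 : ℝ) ≤ 1 / (k : ℝ))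
    rw [one_div] at h ⊢
    rwa [Real.pow_rpow_inv_natCast (by positivity) (by omega)] at h
  have hceil : 2 ^ j ≤ ⌈(N : ℝ) ^ (1 / (k : ℝ))⌉₊ := by
    have := hreal.trans (Nat.le_ceil _)
    exact_mod_cast this
  -- `m < 2^(j+1)`
  have hmlt : m < 2 ^ (j + 1) := Nat.lt_pow_succ_log_self one_lt_two m
  have hkN : lllRate N = k := rfl
  unfold subpolyBound
  rw [hkN]
  have h22 : 22 * 2 ^ j + 22 ≤ c * ⌈(N : ℝ) ^ (1 / (k : ℝ))⌉₊ + c :=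
    Nat.add_le_add (Nat.mul_le_mul hc hceil) hc
  have : 4 * m + 22 ≤ 22 * 2 ^ j + 22 := by rw [pow_succ] at hmlt; omega
  exact this.trans h22

/-- **The `n^{o(1)}` family is not degenerate**: for `c ≥ 22` the empty language lies in
`RSTREAM (subpolyBound lllRate c) (subpolyBound lllRate c)`, a member of the family over which
`SubpolyStreamingHard` quantifies (`lllRate` is nondecreasing and unbounded), so that hypothesis
is a genuine uniform randomized streaming LOWER BOUND. [folklore] -/
theorem zero_mem_RSTREAM_lllRate {c : ℕ} (hc : 22 ≤ c) :
    (0 : Language Bool) ∈ RSTREAM (subpolyBound lllRate c) (subpolyBound lllRate c) :=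
  zero_mem_RSTREAM fun N => log_le_subpolyBound_lllRate hc N

/-- Hence the empty language is NOT `SubpolyStreamingHard` (sanity check of the hypothesis
shape: it fails for trivial languages). [folklore] -/
theorem not_subpolyStreamingHard_zero : ¬ SubpolyStreamingHard (0 : Language Bool) :=
  fun h => h lllRate lllRate_monotone tendsto_lllRate_atTop 22 (zero_mem_RSTREAM_lllRate le_rfl)

end Literature.Computability.MetaComplexity.Fu2020
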